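import Literature.Geometry.Riemannian.FlowC2AlphaNormLSC
import Mathlib.Analysis.Calculus.FDeriv.Symmetric
import HarnessLib

/-!
# Rescaling, recentring and Taylor normalization of `2`-jets on parabolic spacetime

Topic `Literature/Analysis/PDE` (vocabulary of `ParabolicHolderNorm.lean`: `Parabolic E`,
`dilation`, `spaceDeriv`, `timeDeriv`, the regularity guard `IsC21On`).  The jet calculus behind the
blow-up arguments of White (2005, §§2.6, 3, 4) and of Simon's proof of the Schauder estimates:
for `u` satisfying the guard on all of spacetime,

* `spaceDeriv_spaceDeriv_symm` — the spatial Hessian is symmetric (Schwarz);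
* (scalar multiples: `spaceDeriv_const_smul` etc. of `FlowC2AlphaNormLSC.lean`);
* `spaceDeriv_comp_affine`, `spaceDeriv_spaceDeriv_comp_affine`, `timeDeriv_comp_affine`,
  `IsC21On.comp_affine` — recentring and parabolic dilation `Z ↦ u (X₀ + δ_ρ Z)`:
  `D ↦ ρ D`, `D² ↦ ρ² D²`, `∂ₜ ↦ ρ² ∂ₜ`;
* `spaceDeriv_sub`, `spaceDeriv_spaceDeriv_sub`, `timeDeriv_sub`, `IsC21On.sub` — differences;
* `spaceDeriv_quadraticPoly`, `spaceDeriv_spaceDeriv_quadraticPoly`, `timeDeriv_quadraticPoly`,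
  `isC21On_quadraticPoly` — the jets of `a + L x + ½ B(x, x) + t e` (`B` symmetric);
* `exists_blowUp_normalization` — **the normalized blow-up**
  `w = c u(X₀ + δ_ρ ·) - (its parabolic Taylor polynomial of order 2 at 0)`: guard everywhere,
  `w(0) = 0`, `D w(0) = 0`, `D² w = c ρ² (D² u ∘ A - D² u (X₀))`,
  `∂ₜ w = c ρ² (∂ₜ u ∘ A - ∂ₜ u (X₀))`;
* section `Local` (`…_of_mem`, `IsC21On.comp_affine_of_isOpen`,
  `spaceDeriv_spaceDeriv_symm_of_isOpen`, `IsC21On.sub_of_isOpen`,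
  `exists_blowUp_normalization_of_isOpen`) — the same with the guard on an OPEN set `W` only
  (jet formulas at the points of `A⁻¹ W`), for expanding-domain blow-ups.

Everything is PROVED; no definitions, no named facts.

## References

* [White2005] B. White, *A local regularity theorem for mean curvature flow*, Ann. of Math. 161
  (2005), §2.6 and §3 (parabolic dilations `D_λ`, translations, the rescaled functions `ũᵢ`).
-/

noncomputable section

open Set Filter Metric Topology Function

namespace Literature.Analysis.PDE

namespace Parabolic

open Literature.Geometry.Riemannian.ParabolicFlow

variable {E : Type*} [NormedAddCommGroup E] [NormedSpace ℝ E]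
variable {F : Type*} [NormedAddCommGroup F] [NormedSpace ℝ F]

/-! ### Symmetry of the spatial Hessian -/

/-- Under the regularity guard on the whole space, the spatial Hessian `D² u (X)` is symmetric
(Schwarz; Mathlib `second_derivative_symmetric_of_eventually`). [folklore] -/
theorem spaceDeriv_spaceDeriv_symm {u : Parabolic E → F} (h : IsC21On u univ) (X : Parabolic E)
    (v w : E) : spaceDeriv (spaceDeriv u) X v w = spaceDeriv (spaceDeriv u) X w v :=
  second_derivative_symmetric_of_eventually (f := fun x' => u ⟨x', X.t⟩)
    (f' := fun x' => spaceDeriv u ⟨x', X.t⟩)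
    (Eventually.of_forall fun _ => h.hasFDerivAt_space (mem_univ _))
    (h.hasFDerivAt_spaceDeriv (mem_univ _)) v w

/-! ### Scalar multiples

`spaceDeriv_const_smul`, `timeDeriv_const_smul`, `isC21On_const_smul` are in
`Literature.Geometry.Riemannian.FlowC2AlphaNormLSC` (namespace `…ParabolicFlow`, opened here). -/

/-! ### Recentring and parabolic dilation: `u ∘ A`, `A Z = X₀ + δ_ρ Z` -/

section Affine

variable {u : Parabolic E → F} (h : IsC21On u univ) (X₀ : Parabolic E) (ρ : ℝ)

/-- The affine map `z ↦ x₀ + ρ z` on space slices. [folklore] -/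
theorem hasFDerivAt_affine (x₀ : E) (ρ : ℝ) (z : E) :
    HasFDerivAt (fun z' : E => x₀ + ρ • z') (ρ • ContinuousLinearMap.id ℝ E) z := by
  simpa using ((ContinuousLinearMap.id ℝ E).hasFDerivAt.const_smul ρ).const_add x₀

include h in
/-- Space slices of `u ∘ A`: derivative `ρ • D u (A Z)`. [folklore] -/
theorem hasFDerivAt_space_comp_affine (Z : Parabolic E) :
    HasFDerivAt (fun z => u (X₀ + dilation ρ ⟨z, Z.t⟩)) (ρ • spaceDeriv u (X₀ + dilation ρ Z))
      Z.x := by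
  have hin := hasFDerivAt_affine X₀.x ρ Z.x
  have hout : HasFDerivAt (fun x' => u ⟨x', X₀.t + ρ ^ 2 * Z.t⟩)
      (spaceDeriv u (X₀ + dilation ρ Z)) (X₀.x + ρ • Z.x) :=
    h.hasFDerivAt_space (mem_univ _)
  have hcomp := hout.comp Z.x hin
  have hfun : (fun x' => u ⟨x', X₀.t + ρ ^ 2 * Z.t⟩) ∘ (fun z' : E => X₀.x + ρ • z') =
      fun z => u (X₀ + dilation ρ ⟨z, Z.t⟩) := by
    funext z; rfl
  rw [hfun] at hcomp
  convert hcomp using 1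
  ext v
  simp

include h in
/-- `D (u ∘ A) (Z) = ρ • D u (A Z)`. [folklore] -/
theorem spaceDeriv_comp_affine (Z : Parabolic E) :
    spaceDeriv (fun Z' => u (X₀ + dilation ρ Z')) Z = ρ • spaceDeriv u (X₀ + dilation ρ Z) :=
  (hasFDerivAt_space_comp_affine h X₀ ρ Z).fderiv

include h in
/-- Time slices of `u ∘ A`: derivative `ρ² • ∂ₜ u (A Z)`. [folklore] -/
theorem hasDerivAt_time_comp_affine (Z : Parabolic E) :
    HasDerivAt (fun t => u (X₀ + dilation ρ ⟨Z.x, t⟩)) ((ρ ^ 2) • timeDeriv u (X₀ + dilation ρ Z))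
      Z.t := by
  have hin : HasDerivAt (fun t : ℝ => X₀.t + ρ ^ 2 * t) (ρ ^ 2) Z.t := by
    simpa using ((hasDerivAt_id Z.t).const_mul (ρ ^ 2)).const_add X₀.t
  have hout : HasDerivAt (fun t' => u ⟨X₀.x + ρ • Z.x, t'⟩)
      (timeDeriv u (X₀ + dilation ρ Z)) (X₀.t + ρ ^ 2 * Z.t) :=
    h.hasDerivAt_time (mem_univ _)
  have hcomp := hout.scomp Z.t hin
  have hfun : (fun t' => u ⟨X₀.x + ρ • Z.x, t'⟩) ∘ (fun t : ℝ => X₀.t + ρ ^ 2 * t) =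
      fun t => u (X₀ + dilation ρ ⟨Z.x, t⟩) := by
    funext t; rfl
  rwa [hfun] at hcomp

include h in
/-- `∂ₜ (u ∘ A) (Z) = ρ² • ∂ₜ u (A Z)`. [folklore] -/
theorem timeDeriv_comp_affine (Z : Parabolic E) :
    timeDeriv (fun Z' => u (X₀ + dilation ρ Z')) Z = (ρ ^ 2) • timeDeriv u (X₀ + dilation ρ Z) :=
  (hasDerivAt_time_comp_affine h X₀ ρ Z).deriv

include h in
/-- Space slices of `D (u ∘ A)`: derivative `ρ² • D² u (A Z)`. [folklore] -/
theorem hasFDerivAt_spaceDeriv_comp_affine (Z : Parabolic E) :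
    HasFDerivAt (fun z => spaceDeriv (fun Z' => u (X₀ + dilation ρ Z')) ⟨z, Z.t⟩)
      ((ρ ^ 2) • spaceDeriv (spaceDeriv u) (X₀ + dilation ρ Z)) Z.x := by
  have hfun : (fun z => spaceDeriv (fun Z' => u (X₀ + dilation ρ Z')) ⟨z, Z.t⟩) =
      fun z => ρ • spaceDeriv u (X₀ + dilation ρ ⟨z, Z.t⟩) :=
    funext fun z => spaceDeriv_comp_affine h X₀ ρ ⟨z, Z.t⟩
  rw [hfun]
  have hin := hasFDerivAt_affine X₀.x ρ Z.x
  have hout : HasFDerivAt (fun x' => spaceDeriv u ⟨x', X₀.t + ρ ^ 2 * Z.t⟩)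
      (spaceDeriv (spaceDeriv u) (X₀ + dilation ρ Z)) (X₀.x + ρ • Z.x) :=
    h.hasFDerivAt_spaceDeriv (mem_univ _)
  have hcomp : HasFDerivAt (fun z => ρ • spaceDeriv u (X₀ + dilation ρ ⟨z, Z.t⟩))
      (ρ • (spaceDeriv (spaceDeriv u) (X₀ + dilation ρ Z)).comp (ρ • ContinuousLinearMap.id ℝ E))
      Z.x :=
    (hout.comp Z.x hin).const_smul ρ
  convert hcomp using 1
  ext v w
  simp [sq, mul_smul]

include h in
/-- `D² (u ∘ A) (Z) = ρ² • D² u (A Z)`. [folklore] -/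
theorem spaceDeriv_spaceDeriv_comp_affine (Z : Parabolic E) :
    spaceDeriv (spaceDeriv fun Z' => u (X₀ + dilation ρ Z')) Z =
      (ρ ^ 2) • spaceDeriv (spaceDeriv u) (X₀ + dilation ρ Z) :=
  (hasFDerivAt_spaceDeriv_comp_affine h X₀ ρ Z).fderiv

include h in
/-- The guard is preserved by recentring and dilation. [folklore] -/
theorem IsC21On.comp_affine : IsC21On (fun Z' => u (X₀ + dilation ρ Z')) univ := by
  refine ⟨fun Z _ => ?_, fun Z _ => (hasFDerivAt_spaceDeriv_comp_affine h X₀ ρ Z).differentiableAt⟩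
  have hin : DifferentiableAt ℝ (fun p : E × ℝ => (X₀.x + ρ • p.1, X₀.t + ρ ^ 2 * p.2))
      (Z.x, Z.t) :=
    ((differentiableAt_fst.const_smul ρ).const_add _).prodMk
      ((differentiableAt_snd.const_mul _).const_add _)
  have hout : DifferentiableAt ℝ (fun q : E × ℝ => u ⟨q.1, q.2⟩)
      (X₀.x + ρ • Z.x, X₀.t + ρ ^ 2 * Z.t) :=
    h.differentiableAt (X₀ + dilation ρ Z) (mem_univ _)
  have key : DifferentiableAt ℝ ((fun q : E × ℝ => u ⟨q.1, q.2⟩) ∘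
      (fun p : E × ℝ => (X₀.x + ρ • p.1, X₀.t + ρ ^ 2 * p.2))) (Z.x, Z.t) :=
    hout.comp (Z.x, Z.t) hin
  exact key

end Affine

/-! ### Sums and differences -/

section Sub

variable {u p : Parabolic E → F}

/-- `D (u - p) = D u - D p` under the guard. [folklore] -/
theorem spaceDeriv_sub (hu : IsC21On u univ) (hp : IsC21On p univ) :
    spaceDeriv (u - p) = spaceDeriv u - spaceDeriv p := by
  funext X
  exact ((hu.hasFDerivAt_space (mem_univ X)).sub (hp.hasFDerivAt_space (mem_univ X))).fderiv

/-- `∂ₜ (u - p) = ∂ₜ u - ∂ₜ p` under the guard. [folklore] -/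
theorem timeDeriv_sub (hu : IsC21On u univ) (hp : IsC21On p univ) :
    timeDeriv (u - p) = timeDeriv u - timeDeriv p := by
  funext X
  exact ((hu.hasDerivAt_time (mem_univ X)).sub (hp.hasDerivAt_time (mem_univ X))).deriv

/-- Space slices of `D (u - p)`. [folklore] -/
theorem hasFDerivAt_spaceDeriv_sub (hu : IsC21On u univ) (hp : IsC21On p univ) (X : Parabolic E) :
    HasFDerivAt (fun x' => spaceDeriv (u - p) ⟨x', X.t⟩)
      (spaceDeriv (spaceDeriv u) X - spaceDeriv (spaceDeriv p) X) X.x := by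
  rw [spaceDeriv_sub hu hp]
  exact (hu.hasFDerivAt_spaceDeriv (mem_univ X)).sub (hp.hasFDerivAt_spaceDeriv (mem_univ X))

/-- `D² (u - p) = D² u - D² p` under the guard. [folklore] -/
theorem spaceDeriv_spaceDeriv_sub (hu : IsC21On u univ) (hp : IsC21On p univ) :
    spaceDeriv (spaceDeriv (u - p)) = spaceDeriv (spaceDeriv u) - spaceDeriv (spaceDeriv p) := by
  funext X
  exact (hasFDerivAt_spaceDeriv_sub hu hp X).fderiv

/-- The guard is preserved by differences. [folklore] -/
theorem IsC21On.sub (hu : IsC21On u univ) (hp : IsC21On p univ) : IsC21On (u - p) univ :=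
  ⟨fun X _ => (hu.differentiableAt X (mem_univ _)).sub (hp.differentiableAt X (mem_univ _)),
    fun X _ => (hasFDerivAt_spaceDeriv_sub hu hp X).differentiableAt⟩

end Sub

/-! ### Quadratic polynomials `a + L x + ½ B(x, x) + t e` -/

section Quadratic

variable (a e : F) (L : E →L[ℝ] F) (B : E →L[ℝ] E →L[ℝ] F)

/-- The derivative of the quadratic form `x ↦ B(x, x)`: `v ↦ B(x, v) + B(v, x)`. [folklore] -/
theorem hasFDerivAt_quadratic (x : E) :
    HasFDerivAt (fun y : E => B y y) ((B x).comp (ContinuousLinearMap.id ℝ E) + B.flip x) x :=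
  B.hasFDerivAt.clm_apply (hasFDerivAt_id x)

/-- Space slices of the quadratic polynomial: derivative `L + ½ (B(x, ·) + B(·, x))`.
[folklore] -/
theorem hasFDerivAt_space_quadraticPoly (X : Parabolic E) :
    HasFDerivAt (fun x' : E => a + L x' + (1 / 2 : ℝ) • B x' x' + X.t • e)
      (L + (1 / 2 : ℝ) • ((B X.x).comp (ContinuousLinearMap.id ℝ E) + B.flip X.x)) X.x := by
  have h := ((L.hasFDerivAt.const_add a).add ((hasFDerivAt_quadratic B X.x).const_smul
    (1 / 2 : ℝ))).add_const (X.t • e)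
  simpa using h

/-- `D` of the quadratic polynomial with SYMMETRIC `B`: `L + B(x, ·)`. [folklore] -/
theorem spaceDeriv_quadraticPoly (hB : ∀ v w, B v w = B w v) (X : Parabolic E) :
    spaceDeriv (fun Z : Parabolic E => a + L Z.x + (1 / 2 : ℝ) • B Z.x Z.x + Z.t • e) X =
      L + B X.x := by
  rw [spaceDeriv_apply, (hasFDerivAt_space_quadraticPoly a e L B X).fderiv]
  ext v
  simp only [_root_.add_apply, FunLike.coe_smul, Pi.smul_apply,
    ContinuousLinearMap.comp_id, ContinuousLinearMap.flip_apply, hB v X.x]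
  rw [← two_smul ℝ (B X.x v), smul_smul]
  norm_num

/-- `D²` of the quadratic polynomial with symmetric `B` is `B`. [folklore] -/
theorem hasFDerivAt_spaceDeriv_quadraticPoly (hB : ∀ v w, B v w = B w v) (X : Parabolic E) :
    HasFDerivAt (fun x' : E => spaceDeriv
      (fun Z : Parabolic E => a + L Z.x + (1 / 2 : ℝ) • B Z.x Z.x + Z.t • e) ⟨x', X.t⟩) B X.x := by
  have hfun : (fun x' : E => spaceDeriv
      (fun Z : Parabolic E => a + L Z.x + (1 / 2 : ℝ) • B Z.x Z.x + Z.t • e) ⟨x', X.t⟩) =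
      fun x' => L + B x' := funext fun x' => spaceDeriv_quadraticPoly a e L B hB ⟨x', X.t⟩
  rw [hfun]
  simpa using B.hasFDerivAt.const_add L

/-- `D²` of the quadratic polynomial (symmetric `B`): `B`. [folklore] -/
theorem spaceDeriv_spaceDeriv_quadraticPoly (hB : ∀ v w, B v w = B w v) (X : Parabolic E) :
    spaceDeriv (spaceDeriv fun Z : Parabolic E => a + L Z.x + (1 / 2 : ℝ) • B Z.x Z.x + Z.t • e)
      X = B :=
  (hasFDerivAt_spaceDeriv_quadraticPoly a e L B hB X).fderiv

/-- Time slices of the quadratic polynomial: derivative `e`. [folklore] -/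
theorem hasDerivAt_time_quadraticPoly (X : Parabolic E) :
    HasDerivAt (fun t' : ℝ => a + L X.x + (1 / 2 : ℝ) • B X.x X.x + t' • e) e X.t := by
  simpa using ((hasDerivAt_id X.t).smul_const e).const_add (a + L X.x + (1 / 2 : ℝ) • B X.x X.x)

/-- `∂ₜ` of the quadratic polynomial: `e`. [folklore] -/
theorem timeDeriv_quadraticPoly (X : Parabolic E) :
    timeDeriv (fun Z : Parabolic E => a + L Z.x + (1 / 2 : ℝ) • B Z.x Z.x + Z.t • e) X = e :=
  (hasDerivAt_time_quadraticPoly a e L B X).deriv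

/-- Quadratic polynomials (symmetric `B`) satisfy the guard everywhere. [folklore] -/
theorem isC21On_quadraticPoly (hB : ∀ v w, B v w = B w v) :
    IsC21On (fun Z : Parabolic E => a + L Z.x + (1 / 2 : ℝ) • B Z.x Z.x + Z.t • e) univ := by
  refine ⟨fun X _ => ?_,
    fun X _ => (hasFDerivAt_spaceDeriv_quadraticPoly a e L B hB X).differentiableAt⟩
  have h1 : DifferentiableAt ℝ ((L : E → F) ∘ (Prod.fst : E × ℝ → E)) (X.x, X.t) :=
    L.differentiableAt.comp (X.x, X.t) differentiableAt_fst
  have h2 : DifferentiableAt ℝ ((fun y : E => B y y) ∘ (Prod.fst : E × ℝ → E)) (X.x, X.t) :=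
    (hasFDerivAt_quadratic B X.x).differentiableAt.comp (X.x, X.t) differentiableAt_fst
  have h3 : DifferentiableAt ℝ (fun p : E × ℝ => p.2 • e) (X.x, X.t) :=
    differentiableAt_snd.smul_const e
  exact (((differentiableAt_const a).add h1).add (h2.const_smul _)).add h3

end Quadratic

/-! ### The blow-up normalization -/

section BlowUp

/-- The dilation fixes the origin — deprecated alias of the simp lemma `dilation_zero'`
(`FlowC2AlphaNormLSC.lean`, imported), which the proofs below and `ParabolicSchauderBlowUp` now use
directly (librarian dedup-02652). [folklore] -/
@[deprecated dilation_zero' (since := "2026-08-17")]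
alias dilation_zero_eq := dilation_zero'

/-- **The blow-up normalization of White's and Simon's rescaling arguments.**  Given `u` satisfying
the regularity guard everywhere, a centre `X₀`, a scale `ρ` and a factor `c`, the function
`w = v - (Taylor polynomial of v of parabolic order 2 at 0)`, `v(Z) = c u(X₀ + δ_ρ Z)`,
satisfies the guard everywhere, vanishes at `0` together with its spatial gradient, and has
`D² w (Z) = c ρ² (D² u (X₀ + δ_ρ Z) - D² u (X₀))`, `∂ₜ w (Z) = c ρ² (∂ₜ u (X₀ + δ_ρ Z) - ∂ₜ u (X₀))`
(the Taylor polynomial uses the symmetric Hessian `D² v (0)`, `spaceDeriv_spaceDeriv_symm`).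
[folklore] -/
theorem exists_blowUp_normalization {u : Parabolic E → F} (hu : IsC21On u univ)
    (X₀ : Parabolic E) (ρ c : ℝ) :
    ∃ w : Parabolic E → F, IsC21On w univ ∧ w 0 = 0 ∧ spaceDeriv w 0 = 0 ∧
      (∀ Z, spaceDeriv (spaceDeriv w) Z = (c * ρ ^ 2) •
        (spaceDeriv (spaceDeriv u) (X₀ + dilation ρ Z) - spaceDeriv (spaceDeriv u) X₀)) ∧
      (∀ Z, timeDeriv w Z = (c * ρ ^ 2) •
        (timeDeriv u (X₀ + dilation ρ Z) - timeDeriv u X₀)) := by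
  -- the rescaled function and its jets
  set v : Parabolic E → F := c • fun Z => u (X₀ + dilation ρ Z) with hv
  have hvC : IsC21On v univ := isC21On_const_smul (hu.comp_affine X₀ ρ) c
  have hDv : ∀ Z, spaceDeriv v Z = (c * ρ) • spaceDeriv u (X₀ + dilation ρ Z) := fun Z => by
    rw [hv, spaceDeriv_const_smul, Pi.smul_apply, spaceDeriv_comp_affine hu, smul_smul]
  have hD2v : ∀ Z, spaceDeriv (spaceDeriv v) Z =
      (c * ρ ^ 2) • spaceDeriv (spaceDeriv u) (X₀ + dilation ρ Z) := fun Z => by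
    rw [hv, spaceDeriv_const_smul, spaceDeriv_const_smul, Pi.smul_apply,
      spaceDeriv_spaceDeriv_comp_affine hu, smul_smul]
  have hTv : ∀ Z, timeDeriv v Z = (c * ρ ^ 2) • timeDeriv u (X₀ + dilation ρ Z) := fun Z => by
    rw [hv, timeDeriv_const_smul, Pi.smul_apply, timeDeriv_comp_affine hu, smul_smul]
  -- the Taylor polynomial at `0`
  set B := spaceDeriv (spaceDeriv v) 0 with hB
  have hBs : ∀ y z, B y z = B z y := spaceDeriv_spaceDeriv_symm hvC 0
  set p : Parabolic E → F := fun Z => v 0 + spaceDeriv v 0 Z.x + (1 / 2 : ℝ) • B Z.x Z.x +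
    Z.t • timeDeriv v 0 with hp
  have hpC : IsC21On p univ := isC21On_quadraticPoly _ _ _ _ hBs
  refine ⟨v - p, hvC.sub hpC, ?_, ?_, fun Z => ?_, fun Z => ?_⟩
  · simp [hp]
  · rw [spaceDeriv_sub hvC hpC, Pi.sub_apply, hp, spaceDeriv_quadraticPoly _ _ _ _ hBs]
    simp
  · rw [spaceDeriv_spaceDeriv_sub hvC hpC, Pi.sub_apply, hp,
      spaceDeriv_spaceDeriv_quadraticPoly _ _ _ _ hBs, hB, hD2v, hD2v, dilation_zero', add_zero,
      smul_sub]
  · rw [timeDeriv_sub hvC hpC, Pi.sub_apply, hp, timeDeriv_quadraticPoly, hTv, hTv,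
      dilation_zero', add_zero, smul_sub]

end BlowUp


/-! ### Local versions: regularity guard on an open set `W` only

For the expanding-domain blow-ups (White 2005, pp. 1499, 1505) the functions are only regular on a
ball.  The jet formulas hold at the points `Z` with `A Z = X₀ + δ_ρ Z ∈ W`, and the normalized
function satisfies the guard on `A⁻¹ W`. -/

section Local

variable {u : Parabolic E → F} {W : Set (Parabolic E)} (h : IsC21On u W) (hW : IsOpen W)
  (X₀ : Parabolic E) (ρ : ℝ)

include hW in
/-- The slice `{z | X₀ + δ_ρ (z, t) ∈ W}` is open. [folklore] -/
theorem isOpen_setOf_add_dilation_mem (t : ℝ) :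
    IsOpen {z : E | X₀ + dilation ρ ⟨z, t⟩ ∈ W} := by
  have hfun : (fun z : E => X₀ + dilation ρ ⟨z, t⟩) =
      (homeomorphProd (E := E)).symm ∘ fun z : E => (X₀.x + ρ • z, X₀.t + ρ ^ 2 * t) := by
    funext z; rfl
  have hc : Continuous fun z : E => X₀ + dilation ρ ⟨z, t⟩ := by
    rw [hfun]
    exact (homeomorphProd (E := E)).symm.continuous.comp
      ((continuous_const.add (continuous_const.smul continuous_id)).prodMk continuous_const)
  exact hW.preimage hc

include h in
/-- Space slices of `u ∘ A` at points with `A Z ∈ W`: derivative `ρ • D u (A Z)`. [folklore] -/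
theorem hasFDerivAt_space_comp_affine_of_mem {Z : Parabolic E} (hZ : X₀ + dilation ρ Z ∈ W) :
    HasFDerivAt (fun z => u (X₀ + dilation ρ ⟨z, Z.t⟩)) (ρ • spaceDeriv u (X₀ + dilation ρ Z))
      Z.x := by
  have hin := hasFDerivAt_affine X₀.x ρ Z.x
  have hout : HasFDerivAt (fun x' => u ⟨x', X₀.t + ρ ^ 2 * Z.t⟩)
      (spaceDeriv u (X₀ + dilation ρ Z)) (X₀.x + ρ • Z.x) :=
    h.hasFDerivAt_space hZ
  have hcomp := hout.comp Z.x hin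
  have hfun : (fun x' => u ⟨x', X₀.t + ρ ^ 2 * Z.t⟩) ∘ (fun z' : E => X₀.x + ρ • z') =
      fun z => u (X₀ + dilation ρ ⟨z, Z.t⟩) := by
    funext z; rfl
  rw [hfun] at hcomp
  convert hcomp using 1
  ext v
  simp

include h in
/-- `D (u ∘ A) (Z) = ρ • D u (A Z)` for `A Z ∈ W`. [folklore] -/
theorem spaceDeriv_comp_affine_of_mem {Z : Parabolic E} (hZ : X₀ + dilation ρ Z ∈ W) :
    spaceDeriv (fun Z' => u (X₀ + dilation ρ Z')) Z = ρ • spaceDeriv u (X₀ + dilation ρ Z) :=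
  (hasFDerivAt_space_comp_affine_of_mem h X₀ ρ hZ).fderiv

include h in
/-- Time slices of `u ∘ A` at points with `A Z ∈ W`: derivative `ρ² • ∂ₜ u (A Z)`. [folklore] -/
theorem hasDerivAt_time_comp_affine_of_mem {Z : Parabolic E} (hZ : X₀ + dilation ρ Z ∈ W) :
    HasDerivAt (fun t => u (X₀ + dilation ρ ⟨Z.x, t⟩)) ((ρ ^ 2) • timeDeriv u (X₀ + dilation ρ Z))
      Z.t := by
  have hin : HasDerivAt (fun t : ℝ => X₀.t + ρ ^ 2 * t) (ρ ^ 2) Z.t := by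
    simpa using ((hasDerivAt_id Z.t).const_mul (ρ ^ 2)).const_add X₀.t
  have hout : HasDerivAt (fun t' => u ⟨X₀.x + ρ • Z.x, t'⟩)
      (timeDeriv u (X₀ + dilation ρ Z)) (X₀.t + ρ ^ 2 * Z.t) :=
    h.hasDerivAt_time hZ
  have hcomp := hout.scomp Z.t hin
  have hfun : (fun t' => u ⟨X₀.x + ρ • Z.x, t'⟩) ∘ (fun t : ℝ => X₀.t + ρ ^ 2 * t) =
      fun t => u (X₀ + dilation ρ ⟨Z.x, t⟩) := by
    funext t; rfl
  rwa [hfun] at hcomp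

include h in
/-- `∂ₜ (u ∘ A) (Z) = ρ² • ∂ₜ u (A Z)` for `A Z ∈ W`. [folklore] -/
theorem timeDeriv_comp_affine_of_mem {Z : Parabolic E} (hZ : X₀ + dilation ρ Z ∈ W) :
    timeDeriv (fun Z' => u (X₀ + dilation ρ Z')) Z = (ρ ^ 2) • timeDeriv u (X₀ + dilation ρ Z) :=
  (hasDerivAt_time_comp_affine_of_mem h X₀ ρ hZ).deriv

include h hW in
/-- Space slices of `D (u ∘ A)` at points with `A Z ∈ W` (`W` open): derivative
`ρ² • D² u (A Z)`. [folklore] -/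
theorem hasFDerivAt_spaceDeriv_comp_affine_of_mem {Z : Parabolic E} (hZ : X₀ + dilation ρ Z ∈ W) :
    HasFDerivAt (fun z => spaceDeriv (fun Z' => u (X₀ + dilation ρ Z')) ⟨z, Z.t⟩)
      ((ρ ^ 2) • spaceDeriv (spaceDeriv u) (X₀ + dilation ρ Z)) Z.x := by
  -- the formula for `D (u ∘ A)` holds near `Z.x` on the slice
  have hev : (fun z => spaceDeriv (fun Z' => u (X₀ + dilation ρ Z')) ⟨z, Z.t⟩) =ᶠ[𝓝 Z.x]
      fun z => ρ • spaceDeriv u (X₀ + dilation ρ ⟨z, Z.t⟩) := by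
    filter_upwards [(isOpen_setOf_add_dilation_mem hW X₀ ρ Z.t).mem_nhds hZ] with z hz
    exact spaceDeriv_comp_affine_of_mem h X₀ ρ hz
  refine HasFDerivAt.congr_of_eventuallyEq ?_ hev
  have hin := hasFDerivAt_affine X₀.x ρ Z.x
  have hout : HasFDerivAt (fun x' => spaceDeriv u ⟨x', X₀.t + ρ ^ 2 * Z.t⟩)
      (spaceDeriv (spaceDeriv u) (X₀ + dilation ρ Z)) (X₀.x + ρ • Z.x) :=
    h.hasFDerivAt_spaceDeriv hZ
  have hcomp : HasFDerivAt (fun z => ρ • spaceDeriv u (X₀ + dilation ρ ⟨z, Z.t⟩))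
      (ρ • (spaceDeriv (spaceDeriv u) (X₀ + dilation ρ Z)).comp (ρ • ContinuousLinearMap.id ℝ E))
      Z.x :=
    (hout.comp Z.x hin).const_smul ρ
  convert hcomp using 1
  ext v w
  simp [sq, mul_smul]

include h hW in
/-- `D² (u ∘ A) (Z) = ρ² • D² u (A Z)` for `A Z ∈ W` (`W` open). [folklore] -/
theorem spaceDeriv_spaceDeriv_comp_affine_of_mem {Z : Parabolic E} (hZ : X₀ + dilation ρ Z ∈ W) :
    spaceDeriv (spaceDeriv fun Z' => u (X₀ + dilation ρ Z')) Z =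
      (ρ ^ 2) • spaceDeriv (spaceDeriv u) (X₀ + dilation ρ Z) :=
  (hasFDerivAt_spaceDeriv_comp_affine_of_mem h hW X₀ ρ hZ).fderiv

include h hW in
/-- The guard is preserved by recentring and dilation: `u ∘ A` satisfies it on `A⁻¹ W`
(`W` open). [folklore] -/
theorem IsC21On.comp_affine_of_isOpen :
    IsC21On (fun Z' => u (X₀ + dilation ρ Z')) {Z | X₀ + dilation ρ Z ∈ W} := by
  refine ⟨fun Z hZ => ?_,
    fun Z hZ => (hasFDerivAt_spaceDeriv_comp_affine_of_mem h hW X₀ ρ hZ).differentiableAt⟩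
  have hin : DifferentiableAt ℝ (fun p : E × ℝ => (X₀.x + ρ • p.1, X₀.t + ρ ^ 2 * p.2))
      (Z.x, Z.t) :=
    ((differentiableAt_fst.const_smul ρ).const_add _).prodMk
      ((differentiableAt_snd.const_mul _).const_add _)
  have hout : DifferentiableAt ℝ (fun q : E × ℝ => u ⟨q.1, q.2⟩)
      (X₀.x + ρ • Z.x, X₀.t + ρ ^ 2 * Z.t) :=
    h.differentiableAt (X₀ + dilation ρ Z) hZ
  have key : DifferentiableAt ℝ ((fun q : E × ℝ => u ⟨q.1, q.2⟩) ∘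
      (fun p : E × ℝ => (X₀.x + ρ • p.1, X₀.t + ρ ^ 2 * p.2))) (Z.x, Z.t) :=
    hout.comp (Z.x, Z.t) hin
  exact key

/-- Symmetry of the spatial Hessian at a point of an OPEN set carrying the guard. [folklore] -/
theorem spaceDeriv_spaceDeriv_symm_of_isOpen {u : Parabolic E → F} {W : Set (Parabolic E)}
    (h : IsC21On u W) (hW : IsOpen W) {X : Parabolic E} (hX : X ∈ W) (v w : E) :
    spaceDeriv (spaceDeriv u) X v w = spaceDeriv (spaceDeriv u) X w v := by
  have hc : Continuous fun x' : E => (⟨x', X.t⟩ : Parabolic E) :=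
    (homeomorphProd (E := E)).symm.continuous.comp (continuous_id.prodMk continuous_const)
  have hev : ∀ᶠ x' in 𝓝 X.x, HasFDerivAt (fun x'' => u ⟨x'', X.t⟩) (spaceDeriv u ⟨x', X.t⟩) x' := by
    filter_upwards [(hW.preimage hc).mem_nhds (show X.x ∈ {x' | (⟨x', X.t⟩ : Parabolic E) ∈ W}
      from hX)] with x' hx'
    exact h.hasFDerivAt_space hx'
  exact second_derivative_symmetric_of_eventually (f := fun x' => u ⟨x', X.t⟩)
    (f' := fun x' => spaceDeriv u ⟨x', X.t⟩) hev (h.hasFDerivAt_spaceDeriv hX) v w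

/-- `D (u - p) (X) = D u (X) - D p (X)` at a point of the guards. [folklore] -/
theorem spaceDeriv_sub_apply_of_mem {u p : Parabolic E → F} {W : Set (Parabolic E)}
    (hu : IsC21On u W) (hp : IsC21On p W) {X : Parabolic E} (hX : X ∈ W) :
    spaceDeriv (u - p) X = spaceDeriv u X - spaceDeriv p X :=
  ((hu.hasFDerivAt_space hX).sub (hp.hasFDerivAt_space hX)).fderiv

/-- `∂ₜ (u - p) (X) = ∂ₜ u (X) - ∂ₜ p (X)` at a point of the guards. [folklore] -/
theorem timeDeriv_sub_apply_of_mem {u p : Parabolic E → F} {W : Set (Parabolic E)}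
    (hu : IsC21On u W) (hp : IsC21On p W) {X : Parabolic E} (hX : X ∈ W) :
    timeDeriv (u - p) X = timeDeriv u X - timeDeriv p X :=
  ((hu.hasDerivAt_time hX).sub (hp.hasDerivAt_time hX)).deriv

/-- Space slices of `D (u - p)` at a point of an open set carrying the guards. [folklore] -/
theorem hasFDerivAt_spaceDeriv_sub_of_mem {u p : Parabolic E → F} {W : Set (Parabolic E)}
    (hu : IsC21On u W) (hp : IsC21On p W) (hW : IsOpen W) {X : Parabolic E} (hX : X ∈ W) :
    HasFDerivAt (fun x' => spaceDeriv (u - p) ⟨x', X.t⟩)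
      (spaceDeriv (spaceDeriv u) X - spaceDeriv (spaceDeriv p) X) X.x := by
  have hc : Continuous fun x' : E => (⟨x', X.t⟩ : Parabolic E) :=
    (homeomorphProd (E := E)).symm.continuous.comp (continuous_id.prodMk continuous_const)
  have hev : (fun x' => spaceDeriv (u - p) ⟨x', X.t⟩) =ᶠ[𝓝 X.x]
      fun x' => spaceDeriv u ⟨x', X.t⟩ - spaceDeriv p ⟨x', X.t⟩ := by
    filter_upwards [(hW.preimage hc).mem_nhds (show X.x ∈ {x' | (⟨x', X.t⟩ : Parabolic E) ∈ W}
      from hX)] with x' hx'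
    exact spaceDeriv_sub_apply_of_mem hu hp hx'
  exact ((hu.hasFDerivAt_spaceDeriv hX).sub (hp.hasFDerivAt_spaceDeriv hX)).congr_of_eventuallyEq
    hev

/-- `D² (u - p) (X) = D² u (X) - D² p (X)` at a point of an open set carrying the guards.
[folklore] -/
theorem spaceDeriv_spaceDeriv_sub_apply_of_mem {u p : Parabolic E → F} {W : Set (Parabolic E)}
    (hu : IsC21On u W) (hp : IsC21On p W) (hW : IsOpen W) {X : Parabolic E} (hX : X ∈ W) :
    spaceDeriv (spaceDeriv (u - p)) X = spaceDeriv (spaceDeriv u) X - spaceDeriv (spaceDeriv p) X :=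
  (hasFDerivAt_spaceDeriv_sub_of_mem hu hp hW hX).fderiv

/-- The guard on an open set is preserved by differences. [folklore] -/
theorem IsC21On.sub_of_isOpen {u p : Parabolic E → F} {W : Set (Parabolic E)}
    (hu : IsC21On u W) (hp : IsC21On p W) (hW : IsOpen W) : IsC21On (u - p) W :=
  ⟨fun X hX => (hu.differentiableAt X hX).sub (hp.differentiableAt X hX),
    fun _ hX => (hasFDerivAt_spaceDeriv_sub_of_mem hu hp hW hX).differentiableAt⟩

/-- **The blow-up normalization, local form.**  As `exists_blowUp_normalization`, for `u`
satisfying the guard on an OPEN set `W ∋ X₀` only: `w` satisfies the guard on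
`A⁻¹ W = {Z | X₀ + δ_ρ Z ∈ W}`, vanishes at `0` with its spatial gradient, and the jet formulas
hold at the points of `A⁻¹ W`. [folklore] -/
theorem exists_blowUp_normalization_of_isOpen {u : Parabolic E → F} {W : Set (Parabolic E)}
    (hu : IsC21On u W) (hW : IsOpen W) {X₀ : Parabolic E} (hX₀ : X₀ ∈ W) (ρ c : ℝ) :
    ∃ w : Parabolic E → F, IsC21On w {Z | X₀ + dilation ρ Z ∈ W} ∧ w 0 = 0 ∧
      spaceDeriv w 0 = 0 ∧
      (∀ Z, X₀ + dilation ρ Z ∈ W → spaceDeriv (spaceDeriv w) Z = (c * ρ ^ 2) •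
        (spaceDeriv (spaceDeriv u) (X₀ + dilation ρ Z) - spaceDeriv (spaceDeriv u) X₀)) ∧
      (∀ Z, X₀ + dilation ρ Z ∈ W → timeDeriv w Z = (c * ρ ^ 2) •
        (timeDeriv u (X₀ + dilation ρ Z) - timeDeriv u X₀)) := by
  set W' : Set (Parabolic E) := {Z | X₀ + dilation ρ Z ∈ W} with hW'
  have hW'o : IsOpen W' := by
    have hfun : (fun Z : Parabolic E => X₀ + dilation ρ Z) = (homeomorphProd (E := E)).symm ∘
        (fun p : E × ℝ => (X₀.x + ρ • p.1, X₀.t + ρ ^ 2 * p.2)) ∘ homeomorphProd (E := E) := by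
      funext Z; rfl
    have hc : Continuous fun Z : Parabolic E => X₀ + dilation ρ Z := by
      rw [hfun]
      exact (homeomorphProd (E := E)).symm.continuous.comp
        (((continuous_const.add (continuous_const.smul continuous_fst)).prodMk
          (continuous_const.add (continuous_const.mul continuous_snd))).comp
          (homeomorphProd (E := E)).continuous)
    exact hW.preimage hc
  have h0W' : (0 : Parabolic E) ∈ W' := by
    show X₀ + dilation ρ 0 ∈ W
    rwa [dilation_zero', add_zero]
  -- the rescaled function and its jets on `W'`
  set v : Parabolic E → F := c • fun Z => u (X₀ + dilation ρ Z) with hv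
  have hvC : IsC21On v W' := isC21On_const_smul (hu.comp_affine_of_isOpen hW X₀ ρ) c
  have hDv : ∀ Z ∈ W', spaceDeriv v Z = (c * ρ) • spaceDeriv u (X₀ + dilation ρ Z) := fun Z hZ => by
    rw [hv, spaceDeriv_const_smul, Pi.smul_apply, spaceDeriv_comp_affine_of_mem hu X₀ ρ hZ,
      smul_smul]
  have hD2v : ∀ Z ∈ W', spaceDeriv (spaceDeriv v) Z =
      (c * ρ ^ 2) • spaceDeriv (spaceDeriv u) (X₀ + dilation ρ Z) := fun Z hZ => by
    rw [hv, spaceDeriv_const_smul, spaceDeriv_const_smul, Pi.smul_apply,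
      spaceDeriv_spaceDeriv_comp_affine_of_mem hu hW X₀ ρ hZ, smul_smul]
  have hTv : ∀ Z ∈ W', timeDeriv v Z = (c * ρ ^ 2) • timeDeriv u (X₀ + dilation ρ Z) :=
    fun Z hZ => by
    rw [hv, timeDeriv_const_smul, Pi.smul_apply, timeDeriv_comp_affine_of_mem hu X₀ ρ hZ,
      smul_smul]
  -- the Taylor polynomial at `0`
  set B := spaceDeriv (spaceDeriv v) 0 with hB
  have hBs : ∀ y z, B y z = B z y := spaceDeriv_spaceDeriv_symm_of_isOpen hvC hW'o h0W'
  set p : Parabolic E → F := fun Z => v 0 + spaceDeriv v 0 Z.x + (1 / 2 : ℝ) • B Z.x Z.x +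
    Z.t • timeDeriv v 0 with hp
  have hpC : IsC21On p W' := (isC21On_quadraticPoly _ _ _ _ hBs).mono (subset_univ _)
  have hA0 : X₀ + dilation ρ 0 = X₀ := by rw [dilation_zero', add_zero]
  refine ⟨v - p, hvC.sub_of_isOpen hpC hW'o, ?_, ?_, fun Z hZ => ?_, fun Z hZ => ?_⟩
  · simp [hp]
  · rw [spaceDeriv_sub_apply_of_mem hvC hpC h0W', hp, spaceDeriv_quadraticPoly _ _ _ _ hBs]
    simp
  · rw [spaceDeriv_spaceDeriv_sub_apply_of_mem hvC hpC hW'o hZ, hp,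
      spaceDeriv_spaceDeriv_quadraticPoly _ _ _ _ hBs, hB, hD2v Z hZ, hD2v 0 h0W', hA0, smul_sub]
  · rw [timeDeriv_sub_apply_of_mem hvC hpC hZ, hp, timeDeriv_quadraticPoly, hTv Z hZ, hTv 0 h0W',
      hA0, smul_sub]

end Local

end Parabolic

end Literature.Analysis.PDE
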